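import Summits.BirchSwinnertonDyer.BirchSwinnertonDyer.Theorems.ByReductionTypeAtTwoMultTransportTwistedDescentLocalKummer
import Literature.NumberTheory.EllipticCurves.ZpExtensionGaloisTwistLocal
import Literature.NumberTheory.EllipticCurves.KummerImageIsotropy
import Literature.NumberTheory.EllipticCurves.ArchimedeanWeilPairingDuality
import Literature.NumberTheory.EllipticCurves.TateModuleProofs
import Literature.NumberTheory.GaloisRepresentations.LocalGlobalCohomologyTateProofs
import HarnessLib

/-!
# T-42-mult in the kernel, XXVIII: the Tate LINE at level `p^J` — `C_J = C_v ∩ E[p^J]` is cyclic of order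
# `p^J`, stable under `Γ_{F_v}` in every twist `E[p^J](χ_u)`, MAXIMAL ISOTROPIC for the Weil pairing, and its
# twisted classes die under `twistedTorsionToLocalH1`

Cell `bsd-2adic` (run/shared/lean/pub/bsd-2adic/), seat `bsd-2adic-t42` (BRIEF-T42), GEN 17. HONEST FRAMING:
research route; THEOREMS ONLY (no `def`, no named fact, no instance); nothing booked; nothing re-keyed
(RC-169); BSD is not proved by any of this. PARTITION: X5@2 multiplicative GV-transport rows (K4ᵐ B1·O1; the
LOCAL statement `δ2` at the prime `2` left of `hF3b` by XXVI `…TwistedDescentLocalTwo.lean`) × p = 2 —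
types-the-object-of; bears_on K4 items 19922 / 19923 (`--supports stmt-BirchSwinnertonDyer-19923`).

## What (module-level input of the dual Kummer condition `δ2`, HOME/t42/DESIGN-T42-ADDENDUM-17.md §A17.3)

For a line `C ⊆ E[p^∞]` as delivered by XXVII `exists_tateLine_localKummer` (divisible, `#C[p] = p`; at a
multiplicative `v ∣ p` this is Greenberg–Vatsal's `C ≅ μ_{p^∞}`), and its level-`p^J` part
`C_J = {T ∈ E[p^J] : T ∈ C}` (any submodule `C_J` with that membership, hypothesis `hC`):

* §1 (abelian groups) `exists_generator_of_divisible_of_card` — the `p^k`-torsion of a `p`-divisible subgroup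
  `N` with `#N[p] = p` is cyclic of order `p^k`: there is `x ∈ N` of order `p^k` with `N[p^k] = ℤ x`;
* §2 `exists_generator_line` — hence `C_J = ℤ c₀` with `c₀` of order `p^J`, `#C_J = p^J`;
  `weilPairingHom_eq_zero_of_mem_line` — `C_J` is ISOTROPIC for every alternating biadditive `μ_{p^J}`-valued
  pairing `e` (cyclic); `mem_line_of_forall_weilPairingHom_eq_zero` — and MAXIMAL isotropic: `C_J^⊥ = C_J` for
  `e` non-degenerate (count: `e(c₀, ·)` has image of order `p^J`, so `#C_J^⊥ = #E[p^J]/p^J = p^J`; Silverman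
  III.8.1, `#E[p^J] = p^{2J}` III.6.4);
* §3 `line_le_comap_twistedTorsionGaloisModule` — `C_J` is `Γ_{F_v}`-stable in `E[p^J](χ_u)|_{F_v}` (the twist
  acts by the scalars `u^{κ(σ) mod p^J}`, the decomposition group preserves `C`);
  **`twistedTorsionToLocalH1_oneCocycleClass_eq_zero_of_mem_line`** — every class of `H¹(F_v, E[p^J](χ_u))`
  with a `C_J`-valued cocycle dies under `twistedTorsionToLocalH1` (its cocycle is `C`-valued on `G_K = (ker κ)_v`,
  where the twist is invisible, so XXVII makes it a Kummer coboundary) — Greenberg p. 123 «`L_v` … the image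
  of `H¹(M_η, C_v)`» inside the Kummer condition, at finite level and twisted.

References: [GreenbergLNM1716] §2 pp. 74–76, §4 pp. 123–124; [GreenbergVatsal2000] §2 pp. 14–15;
[SilvermanAEC2009] III.6.4, III.8.1; [MilneADT2006] I §2.
-/

set_option autoImplicit false
set_option linter.dupNamespace false

noncomputable section

open scoped Classical AddSubgroup ContRepresentation

namespace Summit.BirchSwinnertonDyer.BirchSwinnertonDyer.Theorems.MultTransportTwistedDescent

open NumberField IsDedekindDomain Field WeierstrassCurve CategoryTheory
  Literature.NumberTheory.GaloisRepresentations Literature.NumberTheory.EllipticCurves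
  Literature.NumberTheory.EllipticCurves.GreenbergSelmer IsDedekindDomain.HeightOneSpectrum
open Literature.NumberTheory.GaloisRepresentations.DiscreteGaloisModule (MuCarrier)

/-! ## §1 Abelian groups: the `p^k`-torsion of a divisible subgroup with `#[p] = p` is cyclic of order `p^k` -/

section Group

variable {A : Type*} [AddCommGroup A] (N : AddSubgroup A) {p : ℕ} [hp : Fact p.Prime]

omit hp in
/-- Membership in `A[n]` for a natural number `n`: `n • x = 0`. [folklore] -/
theorem mem_torsionBy_natCast_iff (n : ℕ) (x : A) : x ∈ A[(n : ℤ)] ↔ n • x = 0 := by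
  rw [AddSubgroup.torsionBy, Submodule.mem_toAddSubgroup, Submodule.mem_torsionBy_iff]
  change (n : ℤ) • x = 0 ↔ _
  rw [natCast_zsmul]

/-- In a subgroup `N` with `#N[p] = p`, an element of order `p` generates `N[p]`: every `y ∈ N` with
`p y = 0` is a multiple of it (a group of prime order is generated by any non-zero element).
[cite: SilvermanAEC2009, Cor. III.6.4] -/
theorem mem_zmultiples_of_addOrderOf_eq_prime (hcard : Nat.card ↥(N ⊓ A[(p : ℤ)]) = p)
    {z : A} (hz : z ∈ N) (hzo : addOrderOf z = p) {y : A} (hy : y ∈ N) (hpy : p • y = 0) :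
    y ∈ AddSubgroup.zmultiples z := by
  have hzp : p • z = 0 := by rw [← hzo]; exact addOrderOf_nsmul_eq_zero z
  have hzmem : z ∈ N ⊓ A[(p : ℤ)] :=
    AddSubgroup.mem_inf.2 ⟨hz, (mem_torsionBy_natCast_iff p z).2 hzp⟩
  have hymem : y ∈ N ⊓ A[(p : ℤ)] :=
    AddSubgroup.mem_inf.2 ⟨hy, (mem_torsionBy_natCast_iff p y).2 hpy⟩
  have hz0 : (⟨z, hzmem⟩ : ↥(N ⊓ A[(p : ℤ)])) ≠ 0 := by
    intro h
    have h' : z = 0 := congrArg Subtype.val h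
    rw [h', addOrderOf_zero] at hzo
    exact hp.out.one_lt.ne' hzo.symm
  have hgen := mem_zmultiples_of_prime_card hcard (g' := ⟨y, hymem⟩) hz0
  obtain ⟨m, hm⟩ := AddSubgroup.mem_zmultiples_iff.1 hgen
  exact AddSubgroup.mem_zmultiples_iff.2 ⟨m, congrArg Subtype.val hm⟩

/-- **The `p^k`-torsion of a `p`-divisible subgroup `N` with `#N[p] = p` is cyclic of order `p^k`**: there is
`x ∈ N` of order exactly `p^k` such that every `y ∈ N` with `p^k y = 0` is a multiple of `x`. (Induction on
`k`: a `p`-th root `x'` of a generator `x` of `N[p^k]` has order `p^{k+1}`, and `y ∈ N[p^{k+1}]` has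
`p y ∈ ℤ x = ℤ p x'`, so `y − m x' ∈ N[p] = ℤ p^k x'`.) For the Tate line `C ≅ μ_{p^∞}` this is
`C[p^k] ≅ μ_{p^k}`. [cite: GreenbergVatsal2000, §2 p. 14] [cite: SilvermanAEC2009, Cor. III.6.4] -/
theorem exists_generator_of_divisible_of_card (hdiv : ∀ c ∈ N, ∃ c' ∈ N, p • c' = c)
    (hcard : Nat.card ↥(N ⊓ A[(p : ℤ)]) = p) (k : ℕ) :
    ∃ x ∈ N, addOrderOf x = p ^ k ∧ ∀ y ∈ N, p ^ k • y = 0 → y ∈ AddSubgroup.zmultiples x := by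
  induction k with
  | zero =>
    refine ⟨0, N.zero_mem, by rw [addOrderOf_zero, pow_zero], fun y _ hy ↦ ?_⟩
    rw [pow_zero, one_nsmul] at hy
    rw [hy]; exact AddSubgroup.zero_mem _
  | succ k ih =>
    obtain ⟨x, hxN, hxo, hxgen⟩ := ih
    cases k with
    | zero =>
      -- `k = 0`: a non-zero element of `N[p]`
      haveI : Finite ↥(N ⊓ A[(p : ℤ)]) := Nat.finite_of_card_ne_zero (by rw [hcard]; exact hp.out.ne_zero)
      have h1 : 1 < Nat.card ↥(N ⊓ A[(p : ℤ)]) := by rw [hcard]; exact hp.out.one_lt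
      haveI := Finite.one_lt_card_iff_nontrivial.1 h1
      obtain ⟨⟨z, hz⟩, hz0⟩ := exists_ne (0 : ↥(N ⊓ A[(p : ℤ)]))
      have hz0' : z ≠ 0 := fun h ↦ hz0 (Subtype.ext h)
      have hzp : p • z = 0 := (mem_torsionBy_natCast_iff p z).1 (AddSubgroup.mem_inf.1 hz).2
      have hzo : addOrderOf z = p := addOrderOf_eq_prime hzp hz0'
      refine ⟨z, (AddSubgroup.mem_inf.1 hz).1, by rw [zero_add, pow_one]; exact hzo, fun y hy hpy ↦ ?_⟩
      rw [zero_add, pow_one] at hpy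
      exact mem_zmultiples_of_addOrderOf_eq_prime N hcard (AddSubgroup.mem_inf.1 hz).1 hzo hy hpy
    | succ k' =>
      -- `k ≥ 1`: a `p`-th root of the generator
      obtain ⟨x', hx'N, hx'⟩ := hdiv x hxN
      have hx'o : addOrderOf x' = p ^ (k' + 1 + 1) := by
        refine addOrderOf_eq_prime_pow (fun h ↦ ?_) ?_
        · -- `p^{k'+1} x' = p^{k'} x ≠ 0`
          rw [pow_succ, mul_nsmul', hx'] at h
          have hdvd := addOrderOf_dvd_of_nsmul_eq_zero h
          rw [hxo] at hdvd
          exact absurd (Nat.le_of_dvd (pow_pos hp.out.pos _) hdvd)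
            (not_le.2 (Nat.pow_lt_pow_right hp.out.one_lt (Nat.lt_succ_self _)))
        · rw [pow_succ, mul_nsmul', hx', ← hxo]; exact addOrderOf_nsmul_eq_zero x
      refine ⟨x', hx'N, hx'o, fun y hy hpy ↦ ?_⟩
      -- `p y ∈ N[p^{k'+1}] = ℤ x`
      have hpy' : p ^ (k' + 1) • (p • y) = 0 := by rw [← mul_nsmul', ← pow_succ]; exact hpy
      obtain ⟨m, hm⟩ := AddSubgroup.mem_zmultiples_iff.1 (hxgen (p • y) (N.nsmul_mem hy p) hpy')
      -- `p (y − m x') = 0`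
      have h0 : p • (y - m • x') = 0 := by
        rw [nsmul_sub, smul_comm, hx', hm, sub_self]
      -- `p^{k'+1} x'` has order `p` and generates `N[p]`
      have hdvd : p ^ (k' + 1) ∣ addOrderOf x' := by
        rw [hx'o]; exact pow_dvd_pow p (Nat.le_succ _)
      have hzo : addOrderOf (p ^ (k' + 1) • x') = p := by
        rw [addOrderOf_nsmul_of_dvd (pow_ne_zero _ hp.out.ne_zero) hdvd, hx'o, pow_succ,
          Nat.mul_div_cancel_left p (pow_pos hp.out.pos _)]
      have hmem := mem_zmultiples_of_addOrderOf_eq_prime N hcard (N.nsmul_mem hx'N _) hzo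
        (N.sub_mem hy (N.zsmul_mem hx'N m)) h0
      obtain ⟨m', hm'⟩ := AddSubgroup.mem_zmultiples_iff.1 hmem
      refine AddSubgroup.mem_zmultiples_iff.2 ⟨m + m' * (p ^ (k' + 1) : ℕ), ?_⟩
      rw [add_smul, mul_smul, natCast_zsmul, hm']
      abel

end Group

/-! ## §2 The level-`p^J` line `C_J` in `E[p^J]`: cyclic of order `p^J`, maximal isotropic -/

section Line

variable {K : Type} [Field K] [NumberField K] (W : WeierstrassCurve K) [W.IsElliptic] (p : ℕ)
  [hp : Fact p.Prime] (J : ℕ) (N : AddSubgroup (W.geomPrimaryTorsion p))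
  (hdiv : ∀ c ∈ N, ∃ c' ∈ N, p • c' = c)
  (hcard : Nat.card ↥(N ⊓ (↥(W.geomPrimaryTorsion p))[(p : ℤ)]) = p)
  (C : Submodule ℤ (W.geomTorsion ((p ^ J : ℕ) : ℤ)))
  (hC : ∀ T, T ∈ C ↔
    AddSubgroup.inclusion (Literature.Barriers.BirchSwinnertonDyer.geomTorsion_pow_le_geomPrimaryTorsion W p J)
      T ∈ N)

omit [NumberField K] [W.IsElliptic] in
include hdiv hcard hC in
/-- **`C_J = ℤ c₀` with `c₀` of order `p^J`**: the level-`p^J` part of the line is cyclic of order `p^J`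
(§1 transported along `E[p^J] ↪ E[p^∞]`). [cite: GreenbergVatsal2000, §2 p. 14] [cite: SilvermanAEC2009, Cor. III.6.4] -/
theorem exists_generator_line :
    ∃ c₀ ∈ C, addOrderOf c₀ = p ^ J ∧ ∀ T ∈ C, T ∈ AddSubgroup.zmultiples c₀ := by
  obtain ⟨x, hxN, hxo, hxgen⟩ := exists_generator_of_divisible_of_card N hdiv hcard J
  have hxJ : (x : W.geomPoints) ∈ W.geomTorsion ((p ^ J : ℕ) : ℤ) := by
    change (x : W.geomPoints) ∈ AddSubgroup.torsionBy _ _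
    rw [mem_torsionBy_natCast_iff]
    have h : ((p ^ J • x : W.geomPrimaryTorsion p) : W.geomPoints) = 0 := by
      rw [← hxo, addOrderOf_nsmul_eq_zero]; rfl
    rwa [AddSubmonoidClass.coe_nsmul] at h
  set c₀ : W.geomTorsion ((p ^ J : ℕ) : ℤ) := ⟨x, hxJ⟩ with hc₀
  have hincl : AddSubgroup.inclusion
      (Literature.Barriers.BirchSwinnertonDyer.geomTorsion_pow_le_geomPrimaryTorsion W p J) c₀ = x :=
    Subtype.ext rfl
  refine ⟨c₀, (hC c₀).2 (by rw [hincl]; exact hxN), ?_, fun T hT ↦ ?_⟩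
  · have h := addOrderOf_injective _ (AddSubgroup.inclusion_injective
      (Literature.Barriers.BirchSwinnertonDyer.geomTorsion_pow_le_geomPrimaryTorsion W p J)) c₀
    rw [← h, hincl, hxo]
  · have hT' := (hC T).1 hT
    have hTJ : p ^ J • AddSubgroup.inclusion
        (Literature.Barriers.BirchSwinnertonDyer.geomTorsion_pow_le_geomPrimaryTorsion W p J) T = 0 := by
      rw [← map_nsmul, AddSubgroup.torsionBy.nsmul T, map_zero]
    obtain ⟨m, hm⟩ := AddSubgroup.mem_zmultiples_iff.1 (hxgen _ hT' hTJ)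
    refine AddSubgroup.mem_zmultiples_iff.2 ⟨m, AddSubgroup.inclusion_injective
      (Literature.Barriers.BirchSwinnertonDyer.geomTorsion_pow_le_geomPrimaryTorsion W p J) ?_⟩
    rw [map_zsmul, hincl, hm]

omit [NumberField K] [W.IsElliptic] in
include hdiv hcard hC in
/-- `#C_J = p^J`. [cite: GreenbergVatsal2000, §2 p. 14] -/
theorem natCard_line : Nat.card C = p ^ J := by
  obtain ⟨c₀, hc₀, hc₀o, hgen⟩ := exists_generator_line W p J N hdiv hcard C hC
  have heq : C.toAddSubgroup = AddSubgroup.zmultiples c₀ := by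
    refine le_antisymm (fun T hT ↦ hgen T hT) ?_
    exact (AddSubgroup.zmultiples_le (G := W.geomTorsion ((p ^ J : ℕ) : ℤ))).2 hc₀
  have h : Nat.card C = Nat.card (AddSubgroup.zmultiples c₀) := by
    rw [← heq]; rfl
  rw [h, Nat.card_zmultiples, hc₀o]

variable (e : W.geomTorsion ((p ^ J : ℕ) : ℤ) → W.geomTorsion ((p ^ J : ℕ) : ℤ) → AlgebraicClosure K)
  (hμ : ∀ S T, e S T ^ (p ^ J) = 1)
  (hadd₁ : ∀ S₁ S₂ T, e (S₁ + S₂) T = e S₁ T * e S₂ T)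
  (hadd₂ : ∀ S T₁ T₂, e S (T₁ + T₂) = e S T₁ * e S T₂)
  (halt : ∀ T, e T T = 1)

omit [NumberField K] [W.IsElliptic] in
include hdiv hcard hC halt in
/-- **`C_J` is isotropic** for every alternating biadditive `μ_{p^J}`-valued pairing `e` on `E[p^J]`: `C_J` is
cyclic, and `e(a c₀, b c₀) = e(c₀, c₀)^{ab} = 1`. [cite: SilvermanAEC2009, Prop. III.8.1(b)] -/
theorem weilPairingHom_eq_zero_of_mem_line {S T : W.geomTorsion ((p ^ J : ℕ) : ℤ)} (hS : S ∈ C)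
    (hT : T ∈ C) :
    haveI : NeZero (p ^ J) := ⟨pow_ne_zero _ hp.out.ne_zero⟩
    weilPairingHom W (p ^ J) e hμ hadd₁ hadd₂ S T = 0 := by
  obtain ⟨c₀, -, -, hgen⟩ := exists_generator_line W p J N hdiv hcard C hC
  obtain ⟨a, rfl⟩ := AddSubgroup.mem_zmultiples_iff.1 (hgen S hS)
  obtain ⟨b, rfl⟩ := AddSubgroup.mem_zmultiples_iff.1 (hgen T hT)
  simp only [map_zsmul, AddMonoidHom.zsmul_apply, weilPairingHom_self W (p ^ J) e hμ hadd₁ hadd₂ halt,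
    smul_zero]

variable (hnondeg : ∀ T, (∀ S, e S T = 1) → T = 0)

include hdiv hcard hC halt hnondeg in
/-- **`C_J` is MAXIMAL isotropic: `C_J^⊥ = C_J`** — a point `T ∈ E[p^J]` pairing trivially with `C_J` under a
non-degenerate alternating biadditive `μ_{p^J}`-valued `e` lies in `C_J`. (The character `e(c₀, ·)` of
`E[p^J]` has image of order exactly `p^J` — else `p^{J−1} c₀` would pair trivially with everything — so its
kernel `C_J^⊥ ⊇ C_J` has `#E[p^J]/p^J = p^J = #C_J` elements; `#E[p^J] = p^{2J}`, Silverman III.6.4.)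
[cite: SilvermanAEC2009, Prop. III.8.1 and Cor. III.6.4] [cite: MilneADT2006, Ch. I §6] -/
theorem mem_line_of_forall_weilPairingHom_eq_zero (T : W.geomTorsion ((p ^ J : ℕ) : ℤ))
    (hT : haveI : NeZero (p ^ J) := ⟨pow_ne_zero _ hp.out.ne_zero⟩
      ∀ S ∈ C, weilPairingHom W (p ^ J) e hμ hadd₁ hadd₂ S T = 0) : T ∈ C := by
  haveI : NeZero (p ^ J) := ⟨pow_ne_zero _ hp.out.ne_zero⟩
  haveI : CharZero K := charZero_of_injective_algebraMap (algebraMap ℚ K).injective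
  obtain ⟨c₀, hc₀, hc₀o, hgen⟩ := exists_generator_line W p J N hdiv hcard C hC
  set φ : W.geomTorsion ((p ^ J : ℕ) : ℤ) →+ MuCarrier K (p ^ J) :=
    weilPairingHom W (p ^ J) e hμ hadd₁ hadd₂ c₀ with hφ
  -- `C ≤ ker φ`
  have hle : C.toAddSubgroup ≤ φ.ker := fun S hS ↦ by
    rw [AddMonoidHom.mem_ker, hφ]
    exact weilPairingHom_eq_zero_of_mem_line W p J N hdiv hcard C hC e hμ hadd₁ hadd₂ halt hc₀ hS
  -- cardinalities
  have hM : Nat.card (W.geomTorsion ((p ^ J : ℕ) : ℤ)) = p ^ (2 * J) :=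
    W.card_geomTorsion_pow_eq p (card_torsionPoints_eq_sq_holds W (AlgebraicClosure K))
      (Nat.cast_ne_zero.2 hp.out.ne_zero) J
  haveI : Finite (W.geomTorsion ((p ^ J : ℕ) : ℤ)) :=
    Nat.finite_of_card_ne_zero (by rw [hM]; exact pow_ne_zero _ hp.out.ne_zero)
  have hμcard : Nat.card (MuCarrier K (p ^ J)) = p ^ J := natCard_muCarrier K (p ^ J)
  haveI : Finite (MuCarrier K (p ^ J)) :=
    Nat.finite_of_card_ne_zero (by rw [hμcard]; exact pow_ne_zero _ hp.out.ne_zero)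
  -- `#range φ = p^J`
  have hrange_dvd : Nat.card φ.range ∣ p ^ J := by
    have h := AddSubgroup.card_addSubgroup_dvd_card φ.range
    rwa [hμcard] at h
  obtain ⟨i, hiJ, hi⟩ := (Nat.dvd_prime_pow hp.out).1 hrange_dvd
  have hiJ' : i = J := by
    by_contra hne
    have hlt : i < J := lt_of_le_of_ne hiJ hne
    obtain ⟨J', hJ⟩ := Nat.exists_eq_add_of_lt hlt
    -- `p^i` kills the range, hence `p^{i+J'} = p^{J-1}` kills `φ`, hence `p^{J-1} c₀ = 0`
    have hkill : ∀ S, p ^ (i + J') • φ S = 0 := fun S ↦ by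
      have h1 : p ^ i • φ S = 0 := by
        have h := card_nsmul_eq_zero' (G := φ.range) (x := ⟨φ S, ⟨S, rfl⟩⟩)
        rw [hi] at h
        exact congrArg Subtype.val h
      rw [pow_add, mul_comm, mul_nsmul', h1, nsmul_zero]
    have hzero : weilPairingHom W (p ^ J) e hμ hadd₁ hadd₂ (p ^ (i + J') • c₀) = 0 := by
      refine AddMonoidHom.ext fun S ↦ ?_
      rw [map_nsmul, AddMonoidHom.nsmul_apply, AddMonoidHom.zero_apply]
      exact hkill S
    have hc : p ^ (i + J') • c₀ = 0 :=
      (injective_iff_map_eq_zero _).1 (weilPairingHom_injective W (p ^ J) e hμ hadd₁ hadd₂ halt hnondeg) _ hzero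
    have hdvd := addOrderOf_dvd_of_nsmul_eq_zero hc
    rw [hc₀o, hJ] at hdvd
    exact absurd (Nat.le_of_dvd (pow_pos hp.out.pos _) hdvd)
      (not_le.2 (Nat.pow_lt_pow_right hp.out.one_lt (Nat.lt_succ_self _)))
  rw [hiJ'] at hi
  -- `#ker φ = p^J = #C`, so `ker φ = C`
  have hker : Nat.card φ.ker = p ^ J := by
    have h := φ.ker.card_mul_index
    rw [AddSubgroup.index_ker, hi, hM, two_mul, pow_add] at h
    exact Nat.eq_of_mul_eq_mul_right (pow_pos hp.out.pos _) h
  have hCcard : Nat.card ↥C.toAddSubgroup = p ^ J := natCard_line W p J N hdiv hcard C hC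
  have heq : C.toAddSubgroup = φ.ker :=
    AddSubgroup.eq_of_le_of_card_ge hle (by rw [hker, hCcard])
  have hTk : T ∈ φ.ker := by rw [AddMonoidHom.mem_ker, hφ]; exact hT c₀ hc₀
  rw [← heq] at hTk
  exact hTk

end Line

/-! ## §3 The line inside the twisted module `E[p^J](χ_u)|_{F_v}`; its classes die under `twistedTorsionToLocalH1` -/

section Twisted

variable {K : Type} [Field K] [NumberField K] (W : WeierstrassCurve K) [W.IsElliptic] (p : ℕ)
  [hp : Fact p.Prime] (κ : ZpExtension K p) (J : ℕ) (u : ℤ) (hu : (p : ℤ) ∣ u - 1)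
  {v : HeightOneSpectrum (𝓞 K)} (N : LocalDatum K (W.geomPrimaryTorsion p) v)
  (C : Submodule ℤ (W.geomTorsion ((p ^ J : ℕ) : ℤ)))
  (hC : ∀ T, T ∈ C ↔
    AddSubgroup.inclusion (Literature.Barriers.BirchSwinnertonDyer.geomTorsion_pow_le_geomPrimaryTorsion W p J)
      T ∈ N.plus)

omit [W.IsElliptic] in
include hC in
/-- **`C_J` is `Γ_{F_v}`-stable in the twisted module `E[p^J](χ_u)|_{F_v}`**: `σ ∈ Γ_{F_v}` acts by
`u^{κ(σ) mod p^J} · σ`, the line `C` is stable under the decomposition group (`LocalDatum.smul_mem`) and under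
scalars. [cite: GreenbergLNM1716, §4 pp. 105, 123] -/
theorem line_le_comap_twistedTorsionGaloisModule (g : absoluteGaloisGroup (v.adicCompletion K)) :
    C ≤ C.comap (((W.twistedTorsionGaloisModule p κ J u hu).restrictField (v.adicCompletion K)) g) := by
  intro T hT
  rw [Submodule.mem_comap]
  refine (hC _).2 ?_
  have h : ((W.twistedTorsionGaloisModule p κ J u hu).restrictField (v.adicCompletion K)) g T =
      (u ^ κ.twistExponent J (absGaloisRestrict K (v.adicCompletion K) g)) •
        (absGaloisRestrict K (v.adicCompletion K) g • T) := rfl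
  rw [h, map_zsmul]
  refine N.plus.zsmul_mem ?_ _
  exact N.smul_mem g ((hC T).1 hT)

omit [W.IsElliptic] in
include hC in
/-- **Classes of `H¹(F_v, E[p^J](χ_u))` with a `C_J`-valued cocycle die under `twistedTorsionToLocalH1`.**
On the local group `G_K = (ker κ)_v` the twist is invisible, so such a cocycle restricts to a continuous
`C`-valued crossed homomorphism of `G_K` into `E[p^∞]`; by XXVII (`hKum`, the local form of Greenberg's
Prop. 2.4-multiplicative) it is a Kummer coboundary `τ ↦ τQ − Q` in `E(F̄_v)`, i.e. the class vanishes in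
`H¹(G_K, E(F̄_v))`. This is the finite-level, twisted form of «`Im(H¹(M_η, C_v)) ⊆ Im(κ)`» (Greenberg p. 123,
the description of `L_v`). [cite: GreenbergLNM1716, §2 pp. 74–76 and §4 pp. 123–124] -/
theorem twistedTorsionToLocalH1_oneCocycleClass_eq_zero_of_mem_line
    (hKum : ∀ (f : localSubgroup κ.kerSubgroup (v.adicCompletion K) → W.geomPrimaryTorsion p),
      (∀ τ, f τ ∈ N.plus) → Continuous f →
      (∀ τ₁ τ₂, f (τ₁ * τ₂) = f τ₁ + resGal (K := K) (v.adicCompletion K)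
        (τ₁ : absoluteGaloisGroup (v.adicCompletion K)) • f τ₂) →
      ∃ Q : localPoints W (v.adicCompletion K),
        ∀ τ : localSubgroup κ.kerSubgroup (v.adicCompletion K),
          pointsMap W (v.adicCompletion K) (f τ : W.geomPoints) =
            (τ : absoluteGaloisGroup (v.adicCompletion K)) • Q - Q)
    (ξ : contOneCocycles
      ((W.twistedTorsionGaloisModule p κ J u hu).restrictField (v.adicCompletion K)).toTopRep)
    (hξ : ∀ σ, ξ.1 σ ∈ C) :
    W.twistedTorsionToLocalH1 p κ J u hu (v.adicCompletion K) (oneCocycleClass _ ξ) = 0 := by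
  rw [twistedTorsionToLocalH1_oneCocycleClass, oneCocycleClass_eq_zero_iff]
  -- the `C`-valued cocycle of `G_K`
  set f : localSubgroup κ.kerSubgroup (v.adicCompletion K) → W.geomPrimaryTorsion p := fun τ ↦
    AddSubgroup.inclusion (Literature.Barriers.BirchSwinnertonDyer.geomTorsion_pow_le_geomPrimaryTorsion W p J)
      (ξ.1 (τ : absoluteGaloisGroup (v.adicCompletion K))) with hfdef
  have hfC : ∀ τ, f τ ∈ N.plus := fun τ ↦ (hC _).1 (hξ _)
  have hfcont : Continuous f :=
    (continuous_of_discreteTopology (f := AddSubgroup.inclusion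
      (Literature.Barriers.BirchSwinnertonDyer.geomTorsion_pow_le_geomPrimaryTorsion W p J))).comp
      (ξ.1.continuous.comp continuous_subtype_val)
  have hfcoc : ∀ τ₁ τ₂, f (τ₁ * τ₂) = f τ₁ + resGal (K := K) (v.adicCompletion K)
      (τ₁ : absoluteGaloisGroup (v.adicCompletion K)) • f τ₂ := by
    intro τ₁ τ₂
    have hτ : absGaloisRestrict K (v.adicCompletion K) (τ₁ : absoluteGaloisGroup (v.adicCompletion K)) ∈
        κ.kerSubgroup := (mem_localSubgroup_iff κ.kerSubgroup (v.adicCompletion K) _).1 τ₁.2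
    simp only [hfdef]
    rw [Subgroup.coe_mul, ξ.2, map_add]
    congr 1
    have h1 : ((W.twistedTorsionGaloisModule p κ J u hu).restrictField (v.adicCompletion K)).toTopRep.ρ
          (τ₁ : absoluteGaloisGroup (v.adicCompletion K)) (ξ.1 τ₂) =
        W.twistedTorsionGaloisModule p κ J u hu
          (absGaloisRestrict K (v.adicCompletion K) (τ₁ : absoluteGaloisGroup (v.adicCompletion K)))
          (ξ.1 τ₂) := rfl
    rw [h1]
    erw [ZpExtension.galoisTwist_apply_of_mem_kerSubgroup _ _ _ _ _ _ hτ, torsionGaloisModule_apply_apply]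
    rfl
  obtain ⟨Q, hQ⟩ := hKum f hfC hfcont hfcoc
  exact ⟨Q, fun τ ↦ hQ τ⟩

end Twisted

end Summit.BirchSwinnertonDyer.BirchSwinnertonDyer.Theorems.MultTransportTwistedDescent

end
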